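import Summits.QuantumFields.YangMills.Theorems.SwapTwistDeficitPeriodicRingFloorLeaderEvent
import Summits.QuantumFields.YangMills.Theorems.SwapTwistDeficitPeriodicRingFloorSharp
import HarnessLib

/-!
# The LOGARITHMIC periodic floor of the zero-flux ring at fixed `L` from a four-letter volume bound:
# `c·t⁶·log t⁻¹ ≤ Haar⁴{nearly commuting}` ⟹ `c_L·u^{9L⁴−3/2}·log u⁻¹ ≤ μ_L{F₀ ≤ u}`, and the Laplace ∕ `TT.physTrace` forms with `log β`
# (free-hands support of item stmt-QuantumFields-24497 `ToronValleyVolume.ToronTubeVolumeLaw`, one-sided fixed-`L` half WITH its logarithm; brick (A1-iii)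
# of the fixed-`L` reduction memo of seat w2 g54 — the four-letter volume theorem itself is seat w2 g54's `ToronLog`, consumed here as a HYPOTHESIS
# of the stated shape so that the two halves land independently)

* §1 the bridge between the Frobenius commutator `‖C_kC_l − C_lC_k‖_F` and the quaternion commutator `‖q(C_k)q(C_l) − q(C_l)q(C_k)‖_ℍ`
  (`‖A − B‖_F = √2·‖q(A) − q(B)‖`, ✓`re_trace_su2Rep_mul_inv_eq_norm`), measurability of the nearly-commuting set;
* §2 ★★ `log_volume_floor_of_fourLetterVolume` — if `c·t⁶·log t⁻¹ ≤ Haar⁴{C : Fin 4 → SU(2) | ∀ k l, ‖q(C_k)q(C_l) − q(C_l)q(C_k)‖ ≤ t}` for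
  `0 < t ≤ t₀ ≤ 1`, then for `0 < u ≤ 1500L⁴t₀²`:
  `(c/2)·(1/34)^{6L⁴−3}·(u/(1500L⁴))^{9L⁴−3/2}·log u⁻¹ ≤ (ringMeasure L).real {F₀ ≤ u}`
  (✓`pi_real_mul_ballVol_pow_le_ringMeasure_real_deficit_le` with the leader event of radius `t = √(u/(1500L⁴))`, `s = √2·t`, fluctuations `t₂ = t`;
  `250(1 + √2)² ≤ 1500`; ✓`pow_three_div_le_ballVol`);
* §3 ★★ `log_laplace_floor_of_fourLetterVolume`, ★★ `log_physTrace_floor_of_fourLetterVolume` — for `β ≥ max 1 (1500L⁴t₀²)⁻¹`: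
  `e^{−1}·(c/2)(1/34)^{6L⁴−3}(1500L⁴β)^{−(9L⁴−3/2)}·log β ≤ ∫e^{−βF₀}dμ_L` and `(1/8)e^{12βL⁴}·(that) ≤ TT.physTrace L β (2L)` — the RLCT
  `9L⁴ − 3/2` WITH its multiplicity-`2` logarithm, at fixed `L`.

HONEST FRAMING: the cheap direction (a floor) of a fixed-`L` Laplace asymptotic, with `exp(−O(L⁴))` constants, conditional on a four-letter volume input of
the stated shape (proved by seat w2 g54, landing separately); ⟨24497⟩ (TWO-sided, `poly(L)`-uniform) is NOT proved, nor ⟨24196⟩, nor any crux, rung or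
summit; the Yang–Mills mass gap is NOT proved; no summit is proved by a line.  THEOREMS ONLY (0 `def`, 0 `sorry`), standard axioms.  Width seat
ym-line-sfw-p2-w3 g61 (cell ym-idea-1, free hands), `--supports stmt-QuantumFields-24497`.
References: [cite: Luscher1983, §2]; [cite: Vanbaal2001]; [cite: GonzalezarroyoAltes1988]; [cite: MontvayMunster1994, (3.145)].
-/

set_option autoImplicit false

noncomputable section

open MeasureTheory
open scoped BigOperators ENNReal Quaternion
open Literature.MathematicalPhysics.QuantumFieldTheory hiding SU2 su2Quat_mul
open Literature.MathematicalPhysics.QuantumLattice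
open Literature.MathematicalPhysics.QuantumFieldTheory.Balaban1983to89.T4HaarSU2Translate (su2Quat_mul continuous_su2Quat)
open Summit.QuantumFields.YangMills.Theorems.FemtoTransferGap
open Summit.QuantumFields.YangMills.Theorems.FemtoTransferGap.TT
open Summit.QuantumFields.YangMills.Theorems.FemtoTransferGap.TwoLattice.ConstTube (re_trace_su2Rep_mul_inv_eq_norm)
open Summit.QuantumFields.YangMills.Theorems.VirialFluxGap.RingDeficit

namespace Summit.QuantumFields.YangMills.Theorems.SwapTwistDeficit.PeriodicRingFloor

variable {L : ℕ} [NeZero L]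

/-! ## §1 Frobenius versus quaternion commutators -/

/-- `‖A − B‖_F = √2 · ‖q(A) − q(B)‖_ℍ` on `SU(2)`. [cite: MontvayMunster1994, §3.2.3 (3.97)] -/
theorem frobNorm_sub_eq_sqrt_two_mul_norm_su2Quat_sub (A B : SU2) :
    frobNorm ((A : Matrix (Fin 2) (Fin 2) ℂ) - (B : Matrix (Fin 2) (Fin 2) ℂ)) = Real.sqrt 2 * ‖su2Quat A - su2Quat B‖ := by
  have h1 := two_sub_re_trace_eq (A * B⁻¹)
  rw [← frobNorm_sub_eq_mul_inv] at h1
  have h2 := re_trace_su2Rep_mul_inv_eq_norm A B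
  rw [fundamentalRep_apply] at h2
  have hsq : frobNorm ((A : Matrix (Fin 2) (Fin 2) ℂ) - (B : Matrix (Fin 2) (Fin 2) ℂ)) ^ 2 = (Real.sqrt 2 * ‖su2Quat A - su2Quat B‖) ^ 2 := by
    rw [mul_pow, Real.sq_sqrt (by norm_num : (0 : ℝ) ≤ 2)]; linarith
  exact (pow_left_inj₀ (frobNorm_nonneg _) (by positivity) two_ne_zero).1 hsq

/-- The Frobenius commutator is `√2` times the quaternion commutator. [folklore] -/
theorem frobNorm_comm_eq_sqrt_two_mul (x y : SU2) :
    frobNorm (((x * y : SU2) : Matrix (Fin 2) (Fin 2) ℂ) - ((y * x : SU2) : Matrix (Fin 2) (Fin 2) ℂ)) =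
      Real.sqrt 2 * ‖su2Quat x * su2Quat y - su2Quat y * su2Quat x‖ := by
  rw [frobNorm_sub_eq_sqrt_two_mul_norm_su2Quat_sub, su2Quat_mul, su2Quat_mul]

/-- Quaternion-nearly-commuting quadruples are Frobenius-nearly-commuting with radius `√2·t`. [folklore] -/
theorem nearlyCommuting_subset (t : ℝ) :
    {C : Fin 4 → SU2 | ∀ k l : Fin 4, ‖su2Quat (C k) * su2Quat (C l) - su2Quat (C l) * su2Quat (C k)‖ ≤ t} ⊆
      {C : Fin 4 → SU2 | ∀ k l : Fin 4,
        frobNorm (((C k * C l : SU2) : Matrix (Fin 2) (Fin 2) ℂ) - ((C l * C k : SU2) : Matrix (Fin 2) (Fin 2) ℂ)) ≤ Real.sqrt 2 * t} := by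
  intro C hC k l
  simp only [Set.mem_setOf_eq] at hC ⊢
  rw [frobNorm_comm_eq_sqrt_two_mul]
  exact mul_le_mul_of_nonneg_left (hC k l) (Real.sqrt_nonneg _)

/-- The nearly-commuting set is measurable (closed). [folklore] -/
theorem measurableSet_nearlyCommuting (t : ℝ) :
    MeasurableSet {C : Fin 4 → SU2 | ∀ k l : Fin 4, ‖su2Quat (C k) * su2Quat (C l) - su2Quat (C l) * su2Quat (C k)‖ ≤ t} := by
  have h : {C : Fin 4 → SU2 | ∀ k l : Fin 4, ‖su2Quat (C k) * su2Quat (C l) - su2Quat (C l) * su2Quat (C k)‖ ≤ t} =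
      ⋂ k : Fin 4, ⋂ l : Fin 4, {C : Fin 4 → SU2 | ‖su2Quat (C k) * su2Quat (C l) - su2Quat (C l) * su2Quat (C k)‖ ≤ t} := by
    ext C; simp only [Set.mem_setOf_eq, Set.mem_iInter]
  rw [h]
  refine MeasurableSet.iInter fun k => MeasurableSet.iInter fun l => ?_
  have hq : ∀ i : Fin 4, Continuous fun C : Fin 4 → SU2 => su2Quat (C i) := fun i => continuous_su2Quat.comp (continuous_apply i)
  exact (isClosed_le (((hq k).mul (hq l)).sub ((hq l).mul (hq k))).norm continuous_const).measurableSet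

/-! ## §2 The logarithmic volume floor from a four-letter volume bound -/

/-- `250·(1 + √2)² ≤ 1500`. [folklore] -/
theorem two_fifty_mul_sq_le : 250 * (1 + Real.sqrt 2) ^ 2 ≤ 1500 := by
  have h2 : Real.sqrt 2 ≤ 71 / 50 := by rw [Real.sqrt_le_left (by norm_num)]; norm_num
  have h0 : 0 ≤ Real.sqrt 2 := Real.sqrt_nonneg _
  have h3 : (1 + Real.sqrt 2) ^ 2 ≤ (1 + 71 / 50) ^ 2 := pow_le_pow_left₀ (by positivity) (by linarith) 2
  nlinarith

/-- ★★ **LOGARITHMIC PERIODIC VOLUME FLOOR FROM A FOUR-LETTER VOLUME BOUND.**  If for `0 < t ≤ t₀` (`t₀ ≤ 1`) the Haar⁴-volume of the quadruples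
`C : Fin 4 → SU(2)` with pairwise quaternion commutators `≤ t` is at least `c·t⁶·log t⁻¹`, then for every `0 < u ≤ 1500·L⁴·t₀²`:
`(c/2)·(1/34)^{6L⁴−3}·(u/(1500L⁴))^{9L⁴−3/2}·log u⁻¹ ≤ (ringMeasure L).real {F₀ ≤ u}`.  Leaders in the nearly-commuting event of radius `t = √(u/(1500L⁴))`
(Frobenius radius `√2·t`), fluctuations `t₂ = t` (✓`pi_real_mul_ballVol_pow_le_ringMeasure_real_deficit_le`, `250(t + √2t)² ≤ 1500t²`), `ballVol t ≥ t³/34`,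
`t⁶·(t³)^{6L⁴−3} = (u/(1500L⁴))^{9L⁴−3/2}`, `log t⁻¹ = ½log(1500L⁴/u) ≥ ½log u⁻¹`. [cite: Luscher1983, §2] [cite: Vanbaal2001] [cite: GonzalezarroyoAltes1988] -/
theorem log_volume_floor_of_fourLetterVolume {c t₀ : ℝ} (hc : 0 < c) (ht₀ : 0 < t₀) (ht₀1 : t₀ ≤ 1)
    (hvol : ∀ t : ℝ, 0 < t → t ≤ t₀ → c * t ^ 6 * Real.log t⁻¹ ≤
      (Measure.pi fun _ : Fin 4 => haarProbability SU2).real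
        {C : Fin 4 → SU2 | ∀ k l : Fin 4, ‖su2Quat (C k) * su2Quat (C l) - su2Quat (C l) * su2Quat (C k)‖ ≤ t})
    {u : ℝ} (hu0 : 0 < u) (hu : u ≤ 1500 * (L : ℝ) ^ 4 * t₀ ^ 2) :
    c / 2 * (1 / 34 : ℝ) ^ (6 * L ^ 4 - 3) * (u / (1500 * (L : ℝ) ^ 4)) ^ (9 * (L : ℝ) ^ 4 - 3 / 2) * Real.log u⁻¹ ≤
      (ringMeasure L).real {P | ringDeficit L (fun _ => false) P ≤ u} := by
  haveI := isProbabilityMeasure_ringMeasure (L := L)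
  have hL1 : 1 ≤ L := NeZero.one_le
  have hL : (1 : ℝ) ≤ L := by exact_mod_cast hL1
  have hK : (0 : ℝ) < 1500 * (L : ℝ) ^ 4 := by positivity
  have hK1 : (1 : ℝ) ≤ 1500 * (L : ℝ) ^ 4 := by nlinarith [one_le_pow₀ (n := 4) hL]
  set x : ℝ := u / (1500 * (L : ℝ) ^ 4) with hx
  have hx0 : 0 < x := div_pos hu0 hK
  set t : ℝ := Real.sqrt x with ht
  have ht0 : 0 < t := Real.sqrt_pos.2 hx0
  have htt₀ : t ≤ t₀ := by
    have hx' : x ≤ t₀ ^ 2 := by rw [hx, div_le_iff₀ hK]; linarith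
    calc t = Real.sqrt x := rfl
      _ ≤ Real.sqrt (t₀ ^ 2) := Real.sqrt_le_sqrt hx'
      _ = t₀ := Real.sqrt_sq ht₀.le
  have ht1 : t ≤ 1 := htt₀.trans ht₀1
  -- a negative right-hand factor makes the claim trivial
  rcases lt_or_ge (Real.log u⁻¹) 0 with hlog | hlog
  · have hneg : c / 2 * (1 / 34 : ℝ) ^ (6 * L ^ 4 - 3) * x ^ (9 * (L : ℝ) ^ 4 - 3 / 2) * Real.log u⁻¹ ≤ 0 :=
      mul_nonpos_of_nonneg_of_nonpos (by positivity) hlog.le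
    exact hneg.trans measureReal_nonneg
  -- the leader event and the box
  have hE := pi_real_mul_ballVol_pow_le_ringMeasure_real_deficit_le (L := L) ht0.le (s := Real.sqrt 2 * t) (by positivity)
    {C : Fin 4 → SU2 | ∀ k l : Fin 4, ‖su2Quat (C k) * su2Quat (C l) - su2Quat (C l) * su2Quat (C k)‖ ≤ t}
    (measurableSet_nearlyCommuting t) (nearlyCommuting_subset t)
  -- the deficit level `250L⁴(t + √2 t)² ≤ u`
  have hlevel : 250 * (L : ℝ) ^ 4 * (t + Real.sqrt 2 * t) ^ 2 ≤ u := by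
    have e1 : 250 * (L : ℝ) ^ 4 * (t + Real.sqrt 2 * t) ^ 2 = 250 * (1 + Real.sqrt 2) ^ 2 * ((L : ℝ) ^ 4 * t ^ 2) := by ring
    have e2 : (L : ℝ) ^ 4 * t ^ 2 = u / 1500 := by
      rw [ht, Real.sq_sqrt hx0.le, hx]; field_simp
    rw [e1, e2]
    have := two_fifty_mul_sq_le
    have hu' : 0 ≤ u / 1500 := by positivity
    nlinarith
  have hmono : (ringMeasure L).real {P | ringDeficit L (fun _ => false) P ≤ 250 * (L : ℝ) ^ 4 * (t + Real.sqrt 2 * t) ^ 2} ≤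
      (ringMeasure L).real {P | ringDeficit L (fun _ => false) P ≤ u} :=
    measureReal_mono (fun P (hP : ringDeficit L (fun _ => false) P ≤ _) => hP.trans hlevel) (measure_ne_top _ _)
  refine le_trans ?_ (hE.trans hmono)
  -- the four-letter volume and the small balls
  have hv := hvol t ht0 htt₀
  have hb : t ^ 3 / 34 ≤ ballVol t := pow_three_div_le_ballVol ht0.le (by linarith)
  have hbpow : (t ^ 3 / 34) ^ (6 * L ^ 4 - 3) ≤ ballVol t ^ (6 * L ^ 4 - 3) := pow_le_pow_left₀ (by positivity) hb _
  have h3 : 3 ≤ 6 * L ^ 4 := by nlinarith [Nat.one_le_pow 4 L hL1]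
  -- `t⁶ · (t³)^{6L⁴−3} = x^{9L⁴−3/2}`
  have hsqrt : ∀ n : ℕ, Real.sqrt x ^ n = x ^ ((n : ℝ) / 2) := fun n => by
    rw [Real.sqrt_eq_rpow, ← Real.rpow_natCast, ← Real.rpow_mul hx0.le]
    congr 1; ring
  have hpow : t ^ 6 * (t ^ 3) ^ (6 * L ^ 4 - 3) = x ^ (9 * (L : ℝ) ^ 4 - 3 / 2) := by
    rw [← pow_mul, ← pow_add, ht, hsqrt]
    congr 1
    rw [Nat.cast_add, Nat.cast_mul, Nat.cast_sub h3]; push_cast; ring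
  -- `log t⁻¹ ≥ ½ log u⁻¹`
  have hlogt : Real.log u⁻¹ / 2 ≤ Real.log t⁻¹ := by
    have e : Real.log t⁻¹ = (Real.log (1500 * (L : ℝ) ^ 4) + Real.log u⁻¹) / 2 := by
      rw [ht, Real.log_inv, Real.log_sqrt hx0.le, hx, Real.log_div hu0.ne' hK.ne', Real.log_inv]; ring
    rw [e]
    have := Real.log_nonneg hK1
    linarith
  calc c / 2 * (1 / 34 : ℝ) ^ (6 * L ^ 4 - 3) * x ^ (9 * (L : ℝ) ^ 4 - 3 / 2) * Real.log u⁻¹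
      = (c * (t ^ 6 * (t ^ 3) ^ (6 * L ^ 4 - 3)) * (Real.log u⁻¹ / 2)) * (1 / 34 : ℝ) ^ (6 * L ^ 4 - 3) := by rw [hpow]; ring
    _ ≤ (c * (t ^ 6 * (t ^ 3) ^ (6 * L ^ 4 - 3)) * Real.log t⁻¹) * (1 / 34 : ℝ) ^ (6 * L ^ 4 - 3) := by
        gcongr
    _ = (c * t ^ 6 * Real.log t⁻¹) * (t ^ 3 / 34) ^ (6 * L ^ 4 - 3) := by
        simp only [div_eq_mul_inv]; ring
    _ ≤ (Measure.pi fun _ : Fin 4 => haarProbability SU2).real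
          {C : Fin 4 → SU2 | ∀ k l : Fin 4, ‖su2Quat (C k) * su2Quat (C l) - su2Quat (C l) * su2Quat (C k)‖ ≤ t} *
        ballVol t ^ (6 * L ^ 4 - 3) :=
        mul_le_mul hv hbpow (by positivity) measureReal_nonneg

/-! ## §3 The logarithmic Laplace and thermal-trace floors -/

/-- ★★ **LOGARITHMIC PERIODIC LAPLACE FLOOR** from a four-letter volume bound: for `β ≥ 1` with `(1500L⁴t₀²)⁻¹ ≤ β`,
`e^{−1}·(c/2)(1/34)^{6L⁴−3}·(1500L⁴β)^{−(9L⁴−3/2)}·log β ≤ ∫e^{−βF₀}dμ_L`. [cite: Luscher1983, §2] [cite: Vanbaal2001] -/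
theorem log_laplace_floor_of_fourLetterVolume {c t₀ : ℝ} (hc : 0 < c) (ht₀ : 0 < t₀) (ht₀1 : t₀ ≤ 1)
    (hvol : ∀ t : ℝ, 0 < t → t ≤ t₀ → c * t ^ 6 * Real.log t⁻¹ ≤
      (Measure.pi fun _ : Fin 4 => haarProbability SU2).real
        {C : Fin 4 → SU2 | ∀ k l : Fin 4, ‖su2Quat (C k) * su2Quat (C l) - su2Quat (C l) * su2Quat (C k)‖ ≤ t})
    {β : ℝ} (hβ : 1 ≤ β) (hβ₀ : (1500 * (L : ℝ) ^ 4 * t₀ ^ 2)⁻¹ ≤ β) :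
    Real.exp (-1) * (c / 2 * (1 / 34 : ℝ) ^ (6 * L ^ 4 - 3) * (1500 * (L : ℝ) ^ 4 * β) ^ (-(9 * (L : ℝ) ^ 4 - 3 / 2)) * Real.log β) ≤
      ∫ P, Real.exp (-(β * ringDeficit L (fun _ => false) P)) ∂(ringMeasure L) := by
  haveI := isProbabilityMeasure_ringMeasure (L := L)
  have hβ0 : 0 < β := by linarith
  have hL : (0 : ℝ) < L := by exact_mod_cast NeZero.pos L
  have hK : (0 : ℝ) < 1500 * (L : ℝ) ^ 4 := by positivity
  have hKt : 0 < 1500 * (L : ℝ) ^ 4 * t₀ ^ 2 := by positivity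
  set S : Set ((Fin (2 * L - 1 + 1) → GaugeConfig 3 L SU2) × (Site 3 L → SU2)) :=
    {P | ringDeficit L (fun _ => false) P ≤ 1 / β} with hS
  have hSm : MeasurableSet S := measurableSet_le (measurable_ringDeficit _) measurable_const
  have hu : 1 / β ≤ 1500 * (L : ℝ) ^ 4 * t₀ ^ 2 := by
    rw [one_div]; exact inv_le_of_inv_le₀ hKt hβ₀
  have hvolu := log_volume_floor_of_fourLetterVolume (L := L) hc ht₀ ht₀1 hvol (u := 1 / β) (by positivity) hu
  have hrew : (1 / β / (1500 * (L : ℝ) ^ 4)) ^ (9 * (L : ℝ) ^ 4 - 3 / 2) = (1500 * (L : ℝ) ^ 4 * β) ^ (-(9 * (L : ℝ) ^ 4 - 3 / 2)) := by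
    rw [Real.rpow_neg (by positivity), ← Real.inv_rpow (by positivity)]
    congr 1; field_simp
  have hlog : Real.log (1 / β)⁻¹ = Real.log β := by rw [one_div, inv_inv]
  rw [hrew, hlog] at hvolu
  have hind : ∀ P, S.indicator (fun _ => Real.exp (-1)) P ≤ Real.exp (-(β * ringDeficit L (fun _ => false) P)) := by
    intro P
    by_cases hP : P ∈ S
    · rw [Set.indicator_of_mem hP, Real.exp_le_exp]
      have h : β * ringDeficit L (fun _ => false) P ≤ β * (1 / β) := mul_le_mul_of_nonneg_left hP hβ0.le
      rw [mul_one_div_cancel hβ0.ne'] at h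
      linarith
    · rw [Set.indicator_of_notMem hP]; exact (Real.exp_pos _).le
  calc Real.exp (-1) * (c / 2 * (1 / 34 : ℝ) ^ (6 * L ^ 4 - 3) * (1500 * (L : ℝ) ^ 4 * β) ^ (-(9 * (L : ℝ) ^ 4 - 3 / 2)) * Real.log β)
      ≤ Real.exp (-1) * (ringMeasure L).real S := mul_le_mul_of_nonneg_left hvolu (Real.exp_pos _).le
    _ = ∫ P, S.indicator (fun _ => Real.exp (-1)) P ∂(ringMeasure L) := by
        rw [integral_indicator_const _ hSm, smul_eq_mul, mul_comm]
    _ ≤ ∫ P, Real.exp (-(β * ringDeficit L (fun _ => false) P)) ∂(ringMeasure L) :=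
        integral_mono ((integrable_const _).indicator hSm) (integrable_exp_neg_mul_ringDeficit β _) hind

/-- ★★ **LOGARITHMIC PERIODIC FLOOR OF THE ZERO-FLUX THERMAL TRACE AT FIXED `L`** from a four-letter volume bound: for `β ≥ 1` with
`(1500L⁴t₀²)⁻¹ ≤ β`, `(1/8)·e^{12βL⁴}·e^{−1}(c/2)(1/34)^{6L⁴−3}(1500L⁴β)^{−(9L⁴−3/2)}·log β ≤ TT.physTrace L β (2L)` — the sharp exponent `9L⁴ − 3/2`
WITH the logarithm of the commuting-holonomy cone (✓`physTraceSucc_eq_sum_sectorWeight`, ✓`sectorWeight_eq_exp_mul_integral_deficit`).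
[cite: Luscher1983, §2] [cite: MontvayMunster1994, (3.145)] -/
theorem log_physTrace_floor_of_fourLetterVolume {c t₀ : ℝ} (hc : 0 < c) (ht₀ : 0 < t₀) (ht₀1 : t₀ ≤ 1)
    (hvol : ∀ t : ℝ, 0 < t → t ≤ t₀ → c * t ^ 6 * Real.log t⁻¹ ≤
      (Measure.pi fun _ : Fin 4 => haarProbability SU2).real
        {C : Fin 4 → SU2 | ∀ k l : Fin 4, ‖su2Quat (C k) * su2Quat (C l) - su2Quat (C l) * su2Quat (C k)‖ ≤ t})
    {β : ℝ} (hβ : 1 ≤ β) (hβ₀ : (1500 * (L : ℝ) ^ 4 * t₀ ^ 2)⁻¹ ≤ β) :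
    (1 / 8 : ℝ) * Real.exp (12 * β * (L : ℝ) ^ 4) *
        (Real.exp (-1) * (c / 2 * (1 / 34 : ℝ) ^ (6 * L ^ 4 - 3) * (1500 * (L : ℝ) ^ 4 * β) ^ (-(9 * (L : ℝ) ^ 4 - 3 / 2)) * Real.log β)) ≤
      TT.physTrace L β (2 * L) := by
  have hlap := log_laplace_floor_of_fourLetterVolume (L := L) hc ht₀ ht₀1 hvol hβ hβ₀
  have hW0 := sectorWeight_eq_exp_mul_integral_deficit (L := L) β (fun _ => false)
  have hsum := physTraceSucc_eq_sum_sectorWeight (L := L) β (2 * L - 1)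
  have hphys : TT.physTrace L β (2 * L) = physTraceSucc L β (2 * L - 1) := rfl
  rw [hphys, hsum]
  have hle : sectorWeight (L := L) β (2 * L - 1) (fun _ => false) (fun _ _ => (1 : ℝ)) ≤
      ∑ z : Fin 3 → Bool, sectorWeight (L := L) β (2 * L - 1) z fun _ _ => (1 : ℝ) :=
    Finset.single_le_sum (f := fun z : Fin 3 → Bool => sectorWeight (L := L) β (2 * L - 1) z fun _ _ => (1 : ℝ))
      (fun z _ => sectorWeight_nonneg β _ z (fun _ _ => zero_le_one)) (Finset.mem_univ _)
  calc (1 / 8 : ℝ) * Real.exp (12 * β * (L : ℝ) ^ 4) *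
        (Real.exp (-1) * (c / 2 * (1 / 34 : ℝ) ^ (6 * L ^ 4 - 3) * (1500 * (L : ℝ) ^ 4 * β) ^ (-(9 * (L : ℝ) ^ 4 - 3 / 2)) * Real.log β))
      ≤ (1 / 8 : ℝ) * (Real.exp (12 * β * (L : ℝ) ^ 4) * ∫ P, Real.exp (-(β * ringDeficit L (fun _ => false) P)) ∂(ringMeasure L)) := by
        rw [mul_assoc]
        exact mul_le_mul_of_nonneg_left (mul_le_mul_of_nonneg_left hlap (Real.exp_pos _).le) (by norm_num)
    _ = (1 / 8 : ℝ) * sectorWeight (L := L) β (2 * L - 1) (fun _ => false) (fun _ _ => (1 : ℝ)) := by rw [hW0]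
    _ ≤ (1 / 8 : ℝ) * ∑ z : Fin 3 → Bool, sectorWeight (L := L) β (2 * L - 1) z fun _ _ => (1 : ℝ) :=
        mul_le_mul_of_nonneg_left hle (by norm_num)

end Summit.QuantumFields.YangMills.Theorems.SwapTwistDeficit.PeriodicRingFloor

end
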